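import Mathlib
import Summits.CriticalPhenomena.CardyFormulaZ2.Theorems.CardySelfRefinementDefs
import Summits.CriticalPhenomena.CardyFormulaZ2.Theorems.CardySelfRefinementGradientComparabilityStubCornerHWBCoarse
import Summits.CriticalPhenomena.CardyFormulaZ2.Theorems.CardySelfRefinementGradientComparabilityStubCornerHWBSegment
import Summits.CriticalPhenomena.CardyFormulaZ2.Theorems.CardySelfRefinementCriticalPathRSWStubPhaseDiagramLandmarksA
import Literature.Probability.Percolation.SelfRefinementMeasure
import Literature.Probability.Percolation.IsoradialArmExtension
import HarnessLib

/-!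
# Crux `GradientComparability` (stmt-CriticalPhenomena-10269), line `monotone-product-coordinates` —
# stub `stub_cornerHardWayBoxes` (HWB): the final assembly modulo the interior-bypass inequality (ii-c)

Route `CardySelfRefinement`; vocabulary from `CardySelfRefinementDefs` (`ax cfg prm M`).  The stub
`stub_cornerHardWayBoxes` (HWB) says: for `k = 2, 3` and every `c₀ > 0` there is a depth `δ > 0` such
that the hard-way box crossings of aspect ratio `8` of the drawing `√2 ℤ²` under `M_k(ρ, c₀)`,
`ρ ∈ [1 - 2δ, 1]`, have probability `≥ 1 - ε` at all scales `n ≥ n₀(ε)`, uniformly in the translate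
`w` and in `ρ` (Aizenman–Grimmett: the interior edges are an essential enhancement of the critical
subdivided coarse percolation at the corner `ρ = 1`).

The route of `hwb_report.md` §2 writes `F(ρ, p, c) = M_k(ρ, c; p)(X)` for the three-parameter coin
law (own coins fair on axial edges and `c` on interior edges, shared coins `p`, selectors `ρ`, pushed
forward by `cfg k`; `M_k(ρ, c) = M_k(ρ, c; 1/2)`) and a box event `X`, and combines
* (i) `hardWayBoxes_one_of_half_lt` (landed, `…StubCornerHWBCoarse`): `F(1, p, c) ≥ 1 - ε` for
  `p > 1/2`, all `c`, at all large scales (Kesten's theorem on `kℤ²`, subdivided);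
* (ii-c) the interior-bypass inequality `∂pF ≤ L ∂cF` on `[1/2, 1] × [1/2, 3/4] × [c₀/2, c₀]` with
  `L` uniform in the scale `n ≥ n₁` and the translate `w` — the HYPOTHESIS of this file;
* (iii′) `hardWayBoxes_segment_integration` (landed, `…StubCornerHWBSegment`): given (ii-c) for `X`,
  `F(1, 1/2 + c₀/(10L), c₀/2) ≤ M_k(ρ, c₀)(X)` for `ρ ∈ [1 - 2δ, 1]`, `δ = c₀/(10L)` (integration of
  Russo's formula along the Aizenman–Grimmett segment, using (ii-ρ) `|∂ρF| ≤ 2 ∂pF` of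
  `…StubCornerHWBRhoLeg`).
THIS FILE (`stub_cornerHardWayBoxes_of_sharedLeInterior`, REGISTERED): (ii-c) `→` (HWB).  Given `k`,
`c₀ > 0`: put `c₁ = min c₀ 1` (the box events are increasing and `M_k(ρ, ·)` is stochastically
increasing, `selfRefinementMeasure_real_mono_right`), take `L, n₁` from (ii-c) at `c₁`,
`δ = c₁/(10L)`; for `ε > 0` take `n₀` from (i) with `p = 1/2 + δ > 1/2`; for `n ≥ max n₀ n₁`, `w`,
`ρ ∈ [1 - 2δ, 1]`: `1 - ε ≤ F(1, 1/2 + δ, c₁/2) ≤ M_k(ρ, c₁)(X) ≤ M_k(ρ, c₀)(X)` for both box events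
(their pull-backs through `cfg k` are finite cylinders: `LandmarksA.exists_determinedBy_preimage`).
(Aizenman–Grimmett, J. Stat. Phys. 63 (1991); Grimmett 1999 §3.3; Bollobás–Riordan 2006 Ch. 3.)
-/

noncomputable section

namespace Summit.CriticalPhenomena.CardyFormulaZ2.Theorems.CardySelfRefinement

open scoped Topology
open Filter Set MeasureTheory
open Literature.Probability.LatticeModels Literature.Probability.Percolation
open Literature.Probability.Percolation.QuadCrossing
open Summit.CriticalPhenomena.CardyFormulaZ2.Theses.CardySelfRefinement
open Summit.CriticalPhenomena.CardyFormulaZ2.Cruxes.CriticalPathRSW.FiniteSizeEnvelope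

/-! ## The box events are finite cylinders on the coin side -/

-- adapted from `finite_tbBox` of Theorems/CardySelfDualSegmentSegmentClosedStubIndepBoxes.lean
/-- The vertex box `{v | √2 v - w ∈ [a₁, b₁] × [a₂, b₂]}` of the drawing `√2 ℤ²` is a finite set of
lattice sites (it lies in an order interval of `ℤ²`). -/
theorem finite_setOf_z_sub_mem_Icc (w : ℂ) (a₁ b₁ a₂ b₂ : ℝ) :
    {v : Site 2 | (squareLatticeEmbedding.z v - w).re ∈ Set.Icc a₁ b₁ ∧
      (squareLatticeEmbedding.z v - w).im ∈ Set.Icc a₂ b₂}.Finite := by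
  have hs : (0 : ℝ) < Real.sqrt 2 := Real.sqrt_pos.2 (by norm_num)
  refine (Set.finite_Icc (![⌈(w.re + a₁) / Real.sqrt 2⌉, ⌈(w.im + a₂) / Real.sqrt 2⌉] : Site 2)
    ![⌊(w.re + b₁) / Real.sqrt 2⌋, ⌊(w.im + b₂) / Real.sqrt 2⌋]).subset ?_
  rintro v ⟨⟨h1, h2⟩, h3, h4⟩
  rw [squareLatticeEmbedding_z_sub_re] at h1 h2
  rw [squareLatticeEmbedding_z_sub_im] at h3 h4
  simp only [Set.mem_Icc, Pi.le_def, Fin.forall_fin_two, Matrix.cons_val_zero,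
    Matrix.cons_val_one]
  refine ⟨⟨Int.ceil_le.2 ?_, Int.ceil_le.2 ?_⟩, Int.le_floor.2 ?_, Int.le_floor.2 ?_⟩
  · rw [div_le_iff₀ hs]; linarith
  · rw [div_le_iff₀ hs]; linarith
  · rw [le_div_iff₀ hs]; linarith
  · rw [le_div_iff₀ hs]; linarith

/-- The pull-back through `cfg k` of an open crossing event of a finite vertex region is determined
by finitely many coins (`PlanarDuality.determinedBy_openCrossing` and the at most three coins read
by each edge, `LandmarksA.exists_determinedBy_preimage`). -/
theorem exists_determinedBy_cfg_preimage_openCrossing (k : ℕ) {S : Set (Site 2)} (hS : S.Finite)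
    (A B : Set (Site 2)) :
    ∃ K : Finset (Site 2 × Fin 2 × Fin 3),
      DeterminedBy ((cfg k) ⁻¹' openCrossing S A B) (↑K : Set (Site 2 × Fin 2 × Fin 3)) := by
  have h := PlanarDuality.determinedBy_openCrossing hS.toFinset A B
  rw [hS.coe_toFinset] at h
  have e : cfg k = refinementConfig k := rfl
  rw [e]
  exact LandmarksA.exists_determinedBy_preimage k h

/-- The pull-back through `cfg k` of a horizontal box crossing of the drawing `√2 ℤ² - w` is
determined by finitely many coins. -/
theorem exists_determinedBy_cfg_preimage_embRectCrossing (k : ℕ) (w : ℂ) (a b : ℝ) :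
    ∃ K : Finset (Site 2 × Fin 2 × Fin 3),
      DeterminedBy ((cfg k) ⁻¹' embRectCrossing (fun v => squareLatticeEmbedding.z v - w) a b)
        (↑K : Set (Site 2 × Fin 2 × Fin 3)) :=
  exists_determinedBy_cfg_preimage_openCrossing k
    (finite_setOf_z_sub_mem_Icc w (-2) (a + 2) 0 b) _ _

/-- The pull-back through `cfg k` of a vertical box crossing of the drawing `√2 ℤ² - w` is
determined by finitely many coins. -/
theorem exists_determinedBy_cfg_preimage_embTBCrossing (k : ℕ) (w : ℂ) (a b : ℝ) :
    ∃ K : Finset (Site 2 × Fin 2 × Fin 3),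
      DeterminedBy ((cfg k) ⁻¹' embTBCrossing (fun v => squareLatticeEmbedding.z v - w) a b)
        (↑K : Set (Site 2 × Fin 2 × Fin 3)) :=
  exists_determinedBy_cfg_preimage_openCrossing k
    (finite_setOf_z_sub_mem_Icc w 0 a (-2) (b + 2)) _ _

/-! ## (ii-c) `→` (HWB) -/

/-- **Stub `stub_cornerHardWayBoxes` (HWB) modulo the interior-bypass inequality (ii-c).**
Assume (ii-c): for `k = 2, 3` and `0 < c₀ ≤ 1` there are `L ≥ 1` and `n₁` such that for all
`n ≥ n₁`, all `w`, and both hard-way box events `X` of aspect ratio `8` at scale `n`, translate `w`,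
the three-parameter crossing probability `F(ρ, p, c) = M_k(ρ, c; p)(X)` satisfies `∂pF ≤ L ∂cF`
(one-sided derivatives within `[0, 1]`) on `ρ ∈ [1/2, 1]`, `p ∈ [1/2, 3/4]`, `c ∈ [c₀/2, c₀]`.
Then (HWB): for `k = 2, 3` and every `c₀ > 0` there is `δ > 0` such that for every `ε > 0`, at all
large scales `n`, for all `w` and all `ρ ∈ [1 - 2δ, 1]`, both hard-way boxes are crossed with
`M_k(ρ, c₀)`-probability `≥ 1 - ε` — with `c₁ = min c₀ 1`, `δ = c₁ / (10 L)`: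
`1 - ε ≤ F(1, 1/2 + δ, c₁/2)` (brick (i), `hardWayBoxes_one_of_half_lt`)
`≤ M_k(ρ, c₁)(X)` (brick (iii′), `hardWayBoxes_segment_integration`, fed with (ii-c))
`≤ M_k(ρ, c₀)(X)` (`selfRefinementMeasure_real_mono_right`). -/
theorem stub_cornerHardWayBoxes_of_sharedLeInterior : (∀ k : ℕ, k = 2 ∨ k = 3 → ∀ c₀ : ℝ, 0 < c₀ → c₀ ≤ 1 → ∃ L : ℝ, 1 ≤ L ∧ ∃ n₁ : ℕ, ∀ n : ℕ, n₁ ≤ n → ∀ w : ℂ, (∀ ρ ∈ Set.Icc (1 / 2 : ℝ) 1, ∀ p ∈ Set.Icc (1 / 2 : ℝ) (3 / 4), ∀ c ∈ Set.Icc (c₀ / 2) c₀, derivWithin (fun p' => ((prodBernoulli (fun i : Site 2 × Fin 2 × Fin 3 => if i.2.2 = 0 then (if ax k (i.1, i.2.1) then half else Set.projIcc (0 : ℝ) 1 zero_le_one c) else if i.2.2 = 1 then Set.projIcc (0 : ℝ) 1 zero_le_one p' else Set.projIcc (0 : ℝ) 1 zero_le_one ρ)).map (cfg k)).real (embRectCrossing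 (fun v => squareLatticeEmbedding.z v - w) (8 * n) n)) (Set.Icc 0 1) p ≤ L * derivWithin (fun c' => ((prodBernoulli (fun i : Site 2 × Fin 2 × Fin 3 => if i.2.2 = 0 then (if ax k (i.1, i.2.1) then half else Set.projIcc (0 : ℝ) 1 zero_le_one c') else if i.2.2 = 1 then Set.projIcc (0 : ℝ) 1 zero_le_one p else Set.projIcc (0 : ℝ) 1 zero_le_one ρ)).map (cfg k)).real (embRectCrossing (fun v => squareLatticeEmbedding.z v - w) (8 * n) n)) (Set.Icc 0 1) c) ∧ (∀ ρ ∈ Set.Icc (1 / 2 : ℝ) 1, ∀ p ∈ Set.Icc (1 / 2 : ℝ) (3 / 4), ∀ c ∈ Set.Icc (c₀ / 2) c₀, derivWithin (fun p' => ((prodBernoulli (fun i : Site 2 × Fin 2 × Fin 3 => if i.2.2 = 0 then (if ax k (i.1, i.2.1) then half else Set.projIcc (0 : ℝ) 1 zero_le_one c) else if i.2.2 = 1 then Set.projIcc (0 : ℝ) 1 zero_le_one p' else Set.projIcc (0 : ℝ) 1 zero_le_one ρ)).map (cfg k)).real (embTBCrossing (fun v => squareLatticeEmbedding.z v - w) n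 (8 * n))) (Set.Icc 0 1) p ≤ L * derivWithin (fun c' => ((prodBernoulli (fun i : Site 2 × Fin 2 × Fin 3 => if i.2.2 = 0 then (if ax k (i.1, i.2.1) then half else Set.projIcc (0 : ℝ) 1 zero_le_one c') else if i.2.2 = 1 then Set.projIcc (0 : ℝ) 1 zero_le_one p else Set.projIcc (0 : ℝ) 1 zero_le_one ρ)).map (cfg k)).real (embTBCrossing (fun v => squareLatticeEmbedding.z v - w) n (8 * n))) (Set.Icc 0 1) c)) → ∀ k : ℕ, k = 2 ∨ k = 3 → ∀ c₀ : ℝ, 0 < c₀ → ∃ δ : ℝ, 0 < δ ∧ ∀ ε : ℝ, 0 < ε → ∃ n₀ : ℕ, ∀ n : ℕ, n₀ ≤ n → ∀ w : ℂ, ∀ ρ ∈ Set.Icc (1 - 2 * δ) 1, 1 - ε ≤ (M k ρ c₀).real (embRectCrossing (fun v => squareLatticeEmbedding.z v - w) (8 * n) n) ∧ 1 - ε ≤ (M k ρ c₀).real (embTBCrossing (fun v => squareLatticeEmbedding.z v - w) n (8 * n)) := by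
  intro hK k hk c₀ hc₀
  have hk0 : 0 < k := by rcases hk with rfl | rfl <;> norm_num
  -- reduce to `c₁ = min c₀ 1 ≤ 1`
  have hc₁0 : 0 < min c₀ 1 := lt_min hc₀ one_pos
  obtain ⟨L, hL, n₁, hn₁⟩ := hK k hk (min c₀ 1) hc₁0 (min_le_right _ _)
  have hL0 : 0 < L := by linarith
  have hδ0 : 0 < min c₀ 1 / (10 * L) := by positivity
  refine ⟨min c₀ 1 / (10 * L), hδ0, fun ε hε => ?_⟩
  -- brick (i) at `p = 1/2 + δ > 1/2`, `c = c₁ / 2`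
  obtain ⟨n₀, hn₀⟩ := hardWayBoxes_one_of_half_lt k hk0 (1 / 2 + min c₀ 1 / (10 * L))
    (by linarith) ε hε
  refine ⟨max n₀ n₁, fun n hn w ρ hρ => ?_⟩
  obtain ⟨h₁, h₂⟩ := hn₀ n (le_of_max_le_left hn) w (min c₀ 1 / 2)
  obtain ⟨H₁, H₂⟩ := hn₁ n (le_of_max_le_right hn) w
  -- brick (iii′) for the two box events, fed with (ii-c)
  obtain ⟨K₁, hK₁⟩ := exists_determinedBy_cfg_preimage_embRectCrossing k w (8 * n) n
  obtain ⟨K₂, hK₂⟩ := exists_determinedBy_cfg_preimage_embTBCrossing k w n (8 * n)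
  have S₁ := hardWayBoxes_segment_integration k _ (isUpperSet_embRectCrossing _ _ _)
    (IsoradialArmExtension.measurableSet_embRectCrossing _ _ _) K₁ hK₁ (min c₀ 1) hc₁0
    (min_le_right _ _) L hL H₁ ρ hρ
  have S₂ := hardWayBoxes_segment_integration k _ (isUpperSet_embTBCrossing _ _ _)
    (IsoradialArmExtension.measurableSet_embTBCrossing _ _ _) K₂ hK₂ (min c₀ 1) hc₁0
    (min_le_right _ _) L hL H₂ ρ hρ
  -- monotonicity in `c` of `M_k(ρ, ·)` on increasing events
  have M₁ : (M k ρ (min c₀ 1)).real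
      (embRectCrossing (fun v => squareLatticeEmbedding.z v - w) (8 * n) n) ≤
      (M k ρ c₀).real (embRectCrossing (fun v => squareLatticeEmbedding.z v - w) (8 * n) n) :=
    selfRefinementMeasure_real_mono_right k ρ (min_le_left c₀ 1) (isUpperSet_embRectCrossing _ _ _)
      (IsoradialArmExtension.measurableSet_embRectCrossing _ _ _)
  have M₂ : (M k ρ (min c₀ 1)).real
      (embTBCrossing (fun v => squareLatticeEmbedding.z v - w) n (8 * n)) ≤
      (M k ρ c₀).real (embTBCrossing (fun v => squareLatticeEmbedding.z v - w) n (8 * n)) :=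
    selfRefinementMeasure_real_mono_right k ρ (min_le_left c₀ 1) (isUpperSet_embTBCrossing _ _ _)
      (IsoradialArmExtension.measurableSet_embTBCrossing _ _ _)
  exact ⟨h₁.trans (S₁.trans M₁), h₂.trans (S₂.trans M₂)⟩

end Summit.CriticalPhenomena.CardyFormulaZ2.Theorems.CardySelfRefinement

end
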